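import Literature.Combinatorics.Additive.TricoloredSumFreeLowerBoundProofs
import Literature.Combinatorics.Additive.BehrendSharp
import Literature.Computability.AlgebraicComplexity.LaserMethodTypesFibreBound
import HarnessLib

/-!
# Kleinberg–Sawin–Speyer 2018, Theorem 2 (the printed subexponential form) — proof

R. Kleinberg, W. Sawin, D. Speyer, *The growth rate of tri-colored sum-free sets*, Discrete
Analysis 2018:12 (arXiv:1607.00047, held `paper:arxiv-1607.00047`), **Theorem 2** (p. 3; Thm. 13,
p. 9): for every integer `q ≥ 2` and all large `n` there are tricolored sum-free sets in `C_qⁿ` of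
size `≥ θⁿ e^{−2√(2 log 2 log θ · n) − O_q(log n)}`.  This file DISCHARGES the named fact
`KleinbergSawinSpeyer2018_thm2` (`TricoloredSumFreeLowerBound.lean`):
`theorem KleinbergSawinSpeyer2018_thm2_holds`.

The `δ`-form `(θ − δ)ⁿ` is `TricoloredSumFreeLowerBoundProofs.lean` (`kleinbergSawinSpeyer2018`,
KSS §§3–4 with Pebody's distribution theorem); the printed form needs three sharpenings of that
argument, supplied here:

* Behrend's bound with the SHARP constant `2√(2 log 2)` (`BehrendSharp.lean`,
  `roth_lower_bound_sharp'`; Mathlib's `Behrend.roth_lower_bound` has `4`) — KSS p. 7 ("Behrend's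
  construction … implies … at least `p e^{−2√(2 log 2 log p)}`"; the polylogarithmic loss of our
  version of Behrend's theorem is absorbed in `O_q(log n)`);
* the size of the Salem–Spencer modulus: `p < 8|V|/|W| ≤ 8|W|` (KSS p. 9), i.e. the largest fibre
  of `V → W` is `≤ |W|` — `exists_free_diagonal_typedSupport_fibre`
  (`LaserMethodTypesFibreBound.lean`), so that `log p ≤ n log θ + O_q(1)`;
* rounding at EVERY scale (KSS §4 ¶1: "within `O_q(1/n)`"): `exists_integral_weight_scale`, and the
  second-order entropy estimate `H(ψ') ≥ log θ − χ²(ψ'‖ψ) = log θ − O_q(1/n²)·n … ` — precisely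
  `n H(ψ') ≥ n log θ − O_q(1)` — by Gibbs' inequality in the form
  `H(p) = log (Z ρ^{−m/3}) − KL(p‖ψ)` for every `p` of mean `m/3` (`entropy_ge_sub_chiSq`; this
  replaces the differentiability remark of KSS §4 ¶1), together with the upper bound
  `H(p) ≤ log θ` (`entropy_le_log_kssTheta`, KSS Remark 6) which bounds `|W| ≤ θⁿ`.

Then (`construction_sharp`, `KleinbergSawinSpeyer2018_thm2_holds`): at length
`n₁ = t⌊n/t⌋ ∈ (n − t, n]` the free diagonal has size
`≥ c |W| e^{−2√(2 log 2 (log|W| + log 3q))}/(96 q √(log |W| + log 3q))` with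
`|W| ≥ θ^{n₁} e^{−O_q(1)} (n₁+1)^{−q}`, which is `θⁿ e^{−2√(2 log 2 log θ · n)} n^{−(q+2)}` for
large `n`; pad by zeros to length `n`.

## References

* [KleinbergSawinSpeyer2018] KSS, Discrete Analysis 2018:12: Thm. 2 (p. 3), §3 Lemma 3, Thm. 4,
  Lemma 5, Remark 6 (p. 6), §4 ¶1, Lemmas 8–12, Thm. 13 (pp. 7–9).
* [Peabody2018] L. Pebody, Discrete Analysis 2018:13, Thm. 4 (`TricoloredSumFreeLowerBoundPebody.lean`).
* [Behrend1946] F. A. Behrend, Proc. Nat. Acad. Sci. USA 32 (1946) 331–332 (`BehrendSharp.lean`).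
* [BurgisserClausenShokrollahi1997] BCS 1997, Thm. 15.39 / proof of Thm. 15.41 (the hashing
  theorem, `LaserHashing.lean`, `LaserMethodTypes.lean`).
-/

noncomputable section

open Finset Real

namespace Literature.Combinatorics.Additive

namespace KleinbergSawinSpeyer

open Literature.Computability.AlgebraicComplexity

/-! ### Rounding at every scale (KSS §4, ¶1) -/

/-- **Rounding to lattice points at every scale** (KSS §4 ¶1: "We can approximate `π` to within
`O_q(1/n)` by an `S₃`-symmetric distribution `π'` where the probability of each element is an
integer multiple of `1/n`"): from a symmetric probability weight `P` on `T = {a + b + c = q − 1}`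
we get, for every `N ≥ 1`, symmetric natural weights on `T` with total `t N` (`t = |T|`) whose
first marginal differs from `t N ·` (that of `P`) by at most a constant `C = C(q)`.
[cite: KleinbergSawinSpeyer2018, §4 (¶1)] -/
theorem exists_integral_weight_scale {q : ℕ} (hq : 1 ≤ q) (P : Fin q × Fin q × Fin q → ℝ)
    (hP0 : ∀ x, 0 ≤ P x) (hPs : ∀ x, P x ≠ 0 → (x.1:ℕ) + x.2.1 + x.2.2 = q - 1)
    (h12 : ∀ a b c, P (a, b, c) = P (b, a, c)) (h23 : ∀ a b c, P (a, b, c) = P (a, c, b))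
    (hP1 : ∑ x, P x = 1) :
    ∃ (t : ℕ) (C : ℝ), 0 < t ∧ 0 ≤ C ∧ ∀ N : ℕ, 0 < N →
      ∃ Pw : Fin q × Fin q × Fin q → ℕ,
        (∀ x, Pw x ≠ 0 → (x.1:ℕ) + x.2.1 + x.2.2 = q - 1) ∧
        (∀ a b c, Pw (a, b, c) = Pw (b, a, c)) ∧ (∀ a b c, Pw (a, b, c) = Pw (a, c, b)) ∧
        ∑ x, Pw x = t * N ∧
        ∀ k : Fin q, |(∑ x ∈ Finset.univ.filter (fun x : Fin q × Fin q × Fin q => x.1 = k),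
            (Pw x : ℝ)) - (t * N : ℕ) *
          ∑ x ∈ Finset.univ.filter (fun x : Fin q × Fin q × Fin q => x.1 = k), P x| ≤ C := by
  classical
  set B : ℝ := (q:ℝ) ^ 3 with hB
  have hB1 : (1:ℝ) ≤ B := one_le_pow₀ (by exact_mod_cast hq)
  have hcardbox : (Fintype.card (Fin q × Fin q × Fin q) : ℝ) = B := by simp [hB]; ring
  haveI : Nonempty (Fin q × Fin q × Fin q) := ⟨(⟨0, by omega⟩, ⟨0, by omega⟩, ⟨0, by omega⟩)⟩
  set T := Finset.univ.filter (fun x : Fin q × Fin q × Fin q => (x.1:ℕ) + x.2.1 + x.2.2 = q - 1)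
    with hT
  have hTne : T.Nonempty := ⟨(⟨0, by omega⟩, ⟨0, by omega⟩, ⟨q - 1, by omega⟩), by simp [hT]⟩
  have hTc : 1 ≤ T.card := Finset.card_pos.2 hTne
  have hTcR : (1:ℝ) ≤ T.card := by exact_mod_cast hTc
  refine ⟨T.card, B * ((T.card : ℝ) * (1 + B)), hTc, by positivity, fun N hN0 => ?_⟩
  have hNpos : (0:ℝ) < N := by exact_mod_cast hN0
  -- rounding down
  set r : Fin q × Fin q × Fin q → ℕ := fun x => ⌊(N:ℝ) * P x⌋₊ with hr
  have hr1 : ∀ x, (r x : ℝ) ≤ N * P x := fun x => Nat.floor_le (mul_nonneg hNpos.le (hP0 x))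
  have hr2 : ∀ x, (N:ℝ) * P x < r x + 1 := fun x => Nat.lt_floor_add_one _
  have hrsum : ((∑ x, r x : ℕ) : ℝ) ≤ N := by
    push_cast
    calc ∑ x, (r x : ℝ) ≤ ∑ x, (N:ℝ) * P x := Finset.sum_le_sum fun x _ => hr1 x
      _ = N := by rw [← Finset.mul_sum, hP1, mul_one]
  have hrsumN : ∑ x, r x ≤ N := by exact_mod_cast hrsum
  set d : ℕ := N - ∑ x, r x with hd
  have hdR : (d:ℝ) = N - ∑ x, (r x : ℝ) := by
    rw [hd, Nat.cast_sub hrsumN]; push_cast; rfl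
  have hdlt : (d:ℝ) < B := by
    rw [hdR, ← hcardbox]
    have : (N:ℝ) - ∑ x, (r x : ℝ) = ∑ x, ((N:ℝ) * P x - r x) := by
      rw [Finset.sum_sub_distrib, ← Finset.mul_sum, hP1, mul_one]
    rw [this]
    calc ∑ x, ((N:ℝ) * P x - r x) < ∑ _x : Fin q × Fin q × Fin q, (1:ℝ) :=
          Finset.sum_lt_sum_of_nonempty Finset.univ_nonempty fun x _ => by linarith [hr2 x]
      _ = Fintype.card (Fin q × Fin q × Fin q) := by simp
  have hrT : ∀ x, x ∉ T → r x = 0 := by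
    intro x hx
    have : P x = 0 := by
      by_contra h
      exact hx (by simp only [hT, Finset.mem_filter, Finset.mem_univ, true_and]; exact hPs x h)
    simp [hr, this]
  -- the integral weights
  refine ⟨fun x => T.card * r x + (if x ∈ T then d else 0),
    fun x hx => ?_, fun a b c => ?_, fun a b c => ?_, ?_, fun k => ?_⟩
  · by_contra hsum
    have hxT : x ∉ T := by
      simp only [hT, Finset.mem_filter, Finset.mem_univ, true_and]; exact hsum
    apply hx
    simp [hrT x hxT, hxT]
  · have hrr : r (a, b, c) = r (b, a, c) := by simp only [hr, h12]
    have hmm : ((a, b, c) ∈ T) ↔ ((b, a, c) ∈ T) := by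
      simp only [hT, Finset.mem_filter, Finset.mem_univ, true_and]; omega
    dsimp only
    rw [hrr, if_congr hmm rfl rfl]
  · have hrr : r (a, b, c) = r (a, c, b) := by simp only [hr, h23]
    have hmm : ((a, b, c) ∈ T) ↔ ((a, c, b) ∈ T) := by
      simp only [hT, Finset.mem_filter, Finset.mem_univ, true_and]; omega
    dsimp only
    rw [hrr, if_congr hmm rfl rfl]
  · rw [Finset.sum_add_distrib, ← Finset.mul_sum, Finset.sum_ite_mem, Finset.univ_inter,
      Finset.sum_const, smul_eq_mul, ← Nat.mul_add, hd, Nat.add_sub_of_le hrsumN]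
  · -- the approximation
    push_cast
    rw [Finset.mul_sum, ← Finset.sum_sub_distrib]
    calc |∑ x ∈ Finset.univ.filter (fun x : Fin q × Fin q × Fin q => x.1 = k),
          (((T.card : ℝ) * r x + (if x ∈ T then (d:ℝ) else 0)) - (T.card : ℝ) * N * P x)|
        ≤ ∑ x ∈ Finset.univ.filter (fun x : Fin q × Fin q × Fin q => x.1 = k),
          |((T.card : ℝ) * r x + (if x ∈ T then (d:ℝ) else 0)) - (T.card : ℝ) * N * P x| :=
          Finset.abs_sum_le_sum_abs _ _
      _ ≤ ∑ _x ∈ Finset.univ.filter (fun x : Fin q × Fin q × Fin q => x.1 = k),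
          (T.card : ℝ) * (1 + B) := by
          refine Finset.sum_le_sum fun x _ => ?_
          have h1 := hr1 x; have h2 := hr2 x
          have hite : 0 ≤ (if x ∈ T then (d:ℝ) else 0) ∧ (if x ∈ T then (d:ℝ) else 0) ≤ B := by
            split_ifs
            · exact ⟨by positivity, hdlt.le⟩
            · exact ⟨le_rfl, by positivity⟩
          rw [abs_le]
          constructor <;> nlinarith [hite.1, hite.2, hTcR]
      _ ≤ B * ((T.card : ℝ) * (1 + B)) := by
          rw [Finset.sum_const, nsmul_eq_mul]
          refine mul_le_mul_of_nonneg_right ?_ (by positivity)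
          rw [← hcardbox]
          exact_mod_cast Finset.card_filter_le _ _

/-! ### Gibbs' inequality against a geometric reference (KSS Lemma 5, Remark 6) -/

/-- Pointwise: `η(p) = p log (r/p) − p log r` for `p ≥ 0 < r` (`η = negMulLog`). [folklore] -/
theorem negMulLog_eq_sub {p r : ℝ} (hp : 0 ≤ p) (hr : 0 < r) :
    Real.negMulLog p = p * Real.log (r / p) - p * Real.log r := by
  rcases eq_or_lt_of_le hp with h | h
  · rw [← h]; simp [Real.negMulLog]
  · rw [Real.negMulLog, Real.log_div hr.ne' h.ne']; ring

/-- Gibbs, upper half: `p log (r/p) ≤ r − p`. [folklore] -/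
theorem mul_log_div_le {p r : ℝ} (hp : 0 ≤ p) (hr : 0 < r) : p * Real.log (r / p) ≤ r - p := by
  rcases eq_or_lt_of_le hp with h | h
  · rw [← h]; simp; exact hr.le
  · have := Real.log_le_sub_one_of_pos (div_pos hr h)
    have e : p * (r / p - 1) = r - p := by field_simp
    calc p * Real.log (r / p) ≤ p * (r / p - 1) := mul_le_mul_of_nonneg_left this hp
      _ = r - p := e

/-- Gibbs, lower half (the `χ²` bound): `p − p²/r ≤ p log (r/p)`. [folklore] -/
theorem sub_sq_div_le_mul_log_div {p r : ℝ} (hp : 0 ≤ p) (hr : 0 < r) :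
    p - p ^ 2 / r ≤ p * Real.log (r / p) := by
  rcases eq_or_lt_of_le hp with h | h
  · rw [← h]; simp
  · have := Real.one_sub_inv_le_log_of_pos (div_pos hr h)
    rw [inv_div] at this
    have e : p * (1 - p / r) = p - p ^ 2 / r := by field_simp
    calc p - p ^ 2 / r = p * (1 - p / r) := e.symm
      _ ≤ p * Real.log (r / p) := mul_le_mul_of_nonneg_left this hp

/-- The cross term against the geometric reference `x^k / P(x)`: for a probability vector `p` on
`{0,…,q−1}` of mean `(q−1)/3`, `−Σ p_k log (x^k/P(x)) = log (P(x) x^{−(q−1)/3})`.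
[cite: KleinbergSawinSpeyer2018, Lemma 5 (proof)] -/
theorem sum_mul_neg_log_geom {q : ℕ} (p : Fin q → ℝ) (hp1 : ∑ k, p k = 1)
    (hmean : ∑ k : Fin q, ((k:ℕ):ℝ) * p k = ((q:ℝ) - 1) / 3) {x : ℝ} (hx0 : 0 < x) :
    -∑ k, p k * Real.log (x ^ (k:ℕ) / ∑ j ∈ Finset.range q, x ^ j) =
      Real.log ((∑ j ∈ Finset.range q, x ^ j) * x ^ (-(((q:ℝ) - 1) / 3))) := by
  set Z := ∑ j ∈ Finset.range q, x ^ j with hZ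
  rcases Nat.eq_zero_or_pos q with hq | hq
  · subst hq; simp at hp1
  have hZpos : 0 < Z := by
    have := Finset.single_le_sum (f := fun i => x ^ i) (fun i _ => pow_nonneg hx0.le i)
      (Finset.mem_range.2 hq)
    simp only [pow_zero] at this
    rw [hZ]; linarith
  have hterm : ∀ k : Fin q, p k * Real.log (x ^ (k:ℕ) / Z) =
      (Real.log x) * (((k:ℕ):ℝ) * p k) - (Real.log Z) * p k := by
    intro k
    rw [Real.log_div (pow_pos hx0 _).ne' hZpos.ne', Real.log_pow]; ring
  rw [Finset.sum_congr rfl fun k _ => hterm k, Finset.sum_sub_distrib, ← Finset.mul_sum,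
    ← Finset.mul_sum, hmean, hp1, Real.log_mul hZpos.ne' (Real.rpow_pos_of_pos hx0 _).ne',
    Real.log_rpow hx0]
  ring

/-- **Entropy upper bound** (KSS Remark 6: "Of all probability distributions on `I` with expected
value `(q−1)/3`, the distribution `ψ` has the greatest entropy"; here in the form needed): a
probability vector on `{0,…,q−1}` with mean `(q−1)/3` has entropy `≤ log θ_q`.
[cite: KleinbergSawinSpeyer2018, Remark 6] -/
theorem entropy_le_log_kssTheta {q : ℕ} (hq : 1 ≤ q) (p : Fin q → ℝ) (hp0 : ∀ k, 0 ≤ p k)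
    (hp1 : ∑ k, p k = 1) (hmean : ∑ k : Fin q, ((k:ℕ):ℝ) * p k = ((q:ℝ) - 1) / 3) :
    ∑ k, Real.negMulLog (p k) ≤ Real.log (kssTheta q) := by
  have key : ∀ x : ℝ, 0 < x → x < 1 → Real.exp (∑ k, Real.negMulLog (p k)) ≤
      (∑ i ∈ Finset.range q, x ^ i) * x ^ (-(((q:ℝ) - 1) / 3)) := by
    intro x hx0 hx1
    set Z := ∑ j ∈ Finset.range q, x ^ j with hZ
    have hZpos : 0 < Z := by
      have := Finset.single_le_sum (f := fun i => x ^ i) (fun i _ => pow_nonneg hx0.le i)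
        (Finset.mem_range.2 hq)
      simp only [pow_zero] at this
      rw [hZ]; linarith
    have hrpos : ∀ k : Fin q, 0 < x ^ (k:ℕ) / Z := fun k => div_pos (pow_pos hx0 _) hZpos
    have hsum : ∑ k, Real.negMulLog (p k) =
        ∑ k, p k * Real.log ((x ^ (k:ℕ) / Z) / p k) - ∑ k, p k * Real.log (x ^ (k:ℕ) / Z) := by
      rw [← Finset.sum_sub_distrib]
      exact Finset.sum_congr rfl fun k _ => negMulLog_eq_sub (hp0 k) (hrpos k)
    have hgibbs : ∑ k, p k * Real.log ((x ^ (k:ℕ) / Z) / p k) ≤ 0 := by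
      calc ∑ k, p k * Real.log ((x ^ (k:ℕ) / Z) / p k) ≤ ∑ k : Fin q, (x ^ (k:ℕ) / Z - p k) :=
            Finset.sum_le_sum fun k _ => mul_log_div_le (hp0 k) (hrpos k)
        _ = (∑ k : Fin q, x ^ (k:ℕ)) / Z - 1 := by
            rw [Finset.sum_sub_distrib, hp1, Finset.sum_div]
        _ = 0 := by
            rw [Fin.sum_univ_eq_sum_range (fun k => x ^ k) q, ← hZ, div_self hZpos.ne', sub_self]
    have hcross := sum_mul_neg_log_geom p hp1 hmean hx0
    rw [← hZ] at hcross
    have hval : 0 < Z * x ^ (-(((q:ℝ) - 1) / 3)) := mul_pos hZpos (Real.rpow_pos_of_pos hx0 _)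
    calc Real.exp (∑ k, Real.negMulLog (p k))
        ≤ Real.exp (Real.log (Z * x ^ (-(((q:ℝ) - 1) / 3)))) := by
          rw [Real.exp_le_exp, hsum, ← hcross]; linarith
      _ = Z * x ^ (-(((q:ℝ) - 1) / 3)) := Real.exp_log hval
  have h := le_kssTheta hq key
  have hθ : 0 < kssTheta q := lt_of_lt_of_le one_pos (one_le_kssTheta hq)
  calc ∑ k, Real.negMulLog (p k) = Real.log (Real.exp (∑ k, Real.negMulLog (p k))) :=
        (Real.log_exp _).symm
    _ ≤ Real.log (kssTheta q) := Real.log_le_log (Real.exp_pos _) h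

/-- **Entropy lower bound near `ψ`** (the second-order replacement for "the entropy is Lipschitz
in a neighbourhood of `ψ`", KSS §4 ¶1): for a probability vector `p` on `{0,…,q−1}` with mean
`(q−1)/3` and the geometric reference `ψ_k = ρ^k/Z`,
`H(p) ≥ log (Z ρ^{−(q−1)/3}) − Σ_k (p_k − ψ_k)²/ψ_k` (Gibbs: `H(p) = log(Zρ^{−(q−1)/3}) − KL(p‖ψ)`
and `KL ≤ χ²`). [cite: KleinbergSawinSpeyer2018, §4 (¶1) and Lemma 5] -/
theorem entropy_ge_sub_chiSq {q : ℕ} (hq : 1 ≤ q) (p : Fin q → ℝ) (hp0 : ∀ k, 0 ≤ p k)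
    (hp1 : ∑ k, p k = 1) (hmean : ∑ k : Fin q, ((k:ℕ):ℝ) * p k = ((q:ℝ) - 1) / 3) {ρ : ℝ} (hρ0 : 0 < ρ) :
    Real.log ((∑ j ∈ Finset.range q, ρ ^ j) * ρ ^ (-(((q:ℝ) - 1) / 3))) -
        ∑ k, (p k - ρ ^ (k:ℕ) / ∑ j ∈ Finset.range q, ρ ^ j) ^ 2 /
          (ρ ^ (k:ℕ) / ∑ j ∈ Finset.range q, ρ ^ j) ≤
      ∑ k, Real.negMulLog (p k) := by
  set Z := ∑ j ∈ Finset.range q, ρ ^ j with hZ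
  have hZpos : 0 < Z := by
    have := Finset.single_le_sum (f := fun i => ρ ^ i) (fun i _ => pow_nonneg hρ0.le i)
      (Finset.mem_range.2 hq)
    simp only [pow_zero] at this
    rw [hZ]; linarith
  have hrpos : ∀ k : Fin q, 0 < ρ ^ (k:ℕ) / Z := fun k => div_pos (pow_pos hρ0 _) hZpos
  have hr1 : ∑ k : Fin q, ρ ^ (k:ℕ) / Z = 1 := by
    rw [← Finset.sum_div, Fin.sum_univ_eq_sum_range (fun k => ρ ^ k) q, ← hZ, div_self hZpos.ne']
  have hsum : ∑ k, Real.negMulLog (p k) =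
      ∑ k, p k * Real.log ((ρ ^ (k:ℕ) / Z) / p k) - ∑ k, p k * Real.log (ρ ^ (k:ℕ) / Z) := by
    rw [← Finset.sum_sub_distrib]
    exact Finset.sum_congr rfl fun k _ => negMulLog_eq_sub (hp0 k) (hrpos k)
  have hcross := sum_mul_neg_log_geom p hp1 hmean hρ0
  rw [← hZ] at hcross
  have hchi : -∑ k, (p k - ρ ^ (k:ℕ) / Z) ^ 2 / (ρ ^ (k:ℕ) / Z) ≤
      ∑ k, p k * Real.log ((ρ ^ (k:ℕ) / Z) / p k) := by
    have e : ∑ k, (p k - ρ ^ (k:ℕ) / Z) ^ 2 / (ρ ^ (k:ℕ) / Z) =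
        ∑ k, (p k ^ 2 / (ρ ^ (k:ℕ) / Z) - 2 * p k + ρ ^ (k:ℕ) / Z) := by
      refine Finset.sum_congr rfl fun k _ => ?_
      have := (hrpos k).ne'
      field_simp
      ring
    rw [e, Finset.sum_add_distrib, Finset.sum_sub_distrib, hr1, ← Finset.mul_sum, hp1]
    calc -(∑ k, p k ^ 2 / (ρ ^ (k:ℕ) / Z) - 2 * 1 + 1) = ∑ k, (p k - p k ^ 2 / (ρ ^ (k:ℕ) / Z)) := by
          rw [Finset.sum_sub_distrib, hp1]; ring
      _ ≤ ∑ k, p k * Real.log ((ρ ^ (k:ℕ) / Z) / p k) :=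
          Finset.sum_le_sum fun k _ => sub_sq_div_le_mul_log_div (hp0 k) (hrpos k)
  rw [hsum, ← hcross]
  linarith


/-! ### The moment identity of a symmetric weight and the construction at one length -/

/-- For symmetric natural weights `Pw` on `{a + b + c = m}` with marginal `μ`,
`3 Σ_k k μ(k) = m Σ_x Pw(x)` (KSS Lemma 8: "the expectation of each variable must be `(q−1)/3`").
[cite: KleinbergSawinSpeyer2018, Lemma 8] -/
theorem three_mul_sum_marginal {m : ℕ} (Pw : Fin (m+1) × Fin (m+1) × Fin (m+1) → ℕ)
    (hsupp : ∀ x, Pw x ≠ 0 → (x.1:ℕ) + x.2.1 + x.2.2 = m)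
    (h12 : ∀ a b c, Pw (a, b, c) = Pw (b, a, c)) (h23 : ∀ a b c, Pw (a, b, c) = Pw (a, c, b)) :
    3 * ∑ k : Fin (m + 1), (k:ℕ) *
        ∑ x ∈ Finset.univ.filter (fun x : Fin (m+1) × Fin (m+1) × Fin (m+1) => x.1 = k), Pw x =
      m * ∑ x, Pw x := by
  classical
  set μ : Fin (m + 1) → ℕ := fun k =>
    ∑ x ∈ Finset.univ.filter (fun x : Fin (m+1) × Fin (m+1) × Fin (m+1) => x.1 = k), Pw x with hμ
  have e1 : ∑ k : Fin (m + 1), (k:ℕ) * μ k = ∑ x, (x.1 : ℕ) * Pw x := by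
    simp only [hμ, Finset.mul_sum]
    rw [← Finset.sum_fiberwise Finset.univ (fun x : Fin (m+1) × Fin (m+1) × Fin (m+1) => x.1)
      (fun x => (x.1 : ℕ) * Pw x)]
    exact Finset.sum_congr rfl fun k _ => Finset.sum_congr rfl fun x hx => by
      rw [(Finset.mem_filter.1 hx).2]
  have e2 : ∑ k : Fin (m + 1), (k:ℕ) * μ k = ∑ x, (x.2.1 : ℕ) * Pw x := by
    simp only [hμ]
    rw [Finset.sum_congr rfl fun k _ => by rw [← marginal_snd_eq Pw h12 k]]
    simp only [Finset.mul_sum]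
    rw [← Finset.sum_fiberwise Finset.univ (fun x : Fin (m+1) × Fin (m+1) × Fin (m+1) => x.2.1)
      (fun x => (x.2.1 : ℕ) * Pw x)]
    exact Finset.sum_congr rfl fun k _ => Finset.sum_congr rfl fun x hx => by
      rw [(Finset.mem_filter.1 hx).2]
  have e3 : ∑ k : Fin (m + 1), (k:ℕ) * μ k = ∑ x, (x.2.2 : ℕ) * Pw x := by
    simp only [hμ]
    rw [Finset.sum_congr rfl fun k _ => by rw [← marginal_thd_eq Pw h12 h23 k]]
    simp only [Finset.mul_sum]
    rw [← Finset.sum_fiberwise Finset.univ (fun x : Fin (m+1) × Fin (m+1) × Fin (m+1) => x.2.2)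
      (fun x => (x.2.2 : ℕ) * Pw x)]
    exact Finset.sum_congr rfl fun k _ => Finset.sum_congr rfl fun x hx => by
      rw [(Finset.mem_filter.1 hx).2]
  have etot : ∑ x, ((x.1 : ℕ) + x.2.1 + x.2.2) * Pw x = m * ∑ x, Pw x := by
    rw [Finset.mul_sum]
    refine Finset.sum_congr rfl fun x _ => ?_
    by_cases hPx : Pw x = 0
    · simp [hPx]
    · rw [hsupp x hPx]
  calc 3 * ∑ k : Fin (m + 1), (k:ℕ) * μ k
      = ∑ x, (x.1 : ℕ) * Pw x + ∑ x, (x.2.1 : ℕ) * Pw x + ∑ x, (x.2.2 : ℕ) * Pw x := by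
        rw [← e1, ← e2, ← e3]; ring
    _ = m * ∑ x, Pw x := by
        rw [← etot, ← Finset.sum_add_distrib, ← Finset.sum_add_distrib]
        exact Finset.sum_congr rfl fun x _ => by ring

/-- `L ↦ e^{−2√(2 log 2 · L)}/√L` is decreasing on `(0, ∞)`. [folklore] -/
theorem behrendFactor_antitone {L₁ L₂ : ℝ} (h₁ : 0 < L₁) (h₁₂ : L₁ ≤ L₂) :
    Real.exp (-2 * Real.sqrt (2 * Real.log 2 * L₂)) / Real.sqrt L₂ ≤
      Real.exp (-2 * Real.sqrt (2 * Real.log 2 * L₁)) / Real.sqrt L₁ := by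
  have hl2 : 0 < Real.log 2 := Real.log_pos one_lt_two
  refine div_le_div₀ (Real.exp_pos _).le ?_ (Real.sqrt_pos.2 h₁) (Real.sqrt_le_sqrt h₁₂)
  exact Real.exp_le_exp.2 (by
    nlinarith [Real.sqrt_le_sqrt (mul_le_mul_of_nonneg_left h₁₂ (by positivity :
      (0:ℝ) ≤ 2 * Real.log 2))])

/-- **KSS §4 at one length, with the sharp constants** (cf. `construction`): given symmetric
natural weights `Pw` on `{a + b + c = q − 1}` with total `n ≥ 1` and marginal `μ`, and Behrend's
theorem in the form `c₀ N e^{−2√(2 log 2 log N)}/√(log N) ≤ rothNumberNat N` (`N ≥ 2`), there is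
a tricolored sum-free family in `(ℤ/q)ⁿ` of size `s` with
`c₀ |W| e^{−2√(2 log 2 · Λ)} / √Λ ≤ 96 q s`, `Λ = log |W| + log (3q)`, `W = W_μ` the type class:
the free diagonal of `exists_free_diagonal_typedSupport_fibre` (whose Salem–Spencer modulus is
`≤ 12 max(f, q−1) ≤ 12 q |W|` by the fibre bound `f ≤ |W|`, KSS p. 9 "`p < 8|V|/|W| ≤ 8|W|`"),
read as the sum-free family `(x_δ, y_δ, z_δ + 1)` by Lemma 9.
[cite: KleinbergSawinSpeyer2018, §4 (Lemmas 8–12, proof of Thm. 13)] -/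
theorem construction_sharp {q : ℕ} (hq : 2 ≤ q) {n : ℕ}
    (Pw : Fin q × Fin q × Fin q → ℕ)
    (hsupp : ∀ x, Pw x ≠ 0 → (x.1:ℕ) + x.2.1 + x.2.2 = q - 1)
    (h12 : ∀ a b c, Pw (a, b, c) = Pw (b, a, c)) (h23 : ∀ a b c, Pw (a, b, c) = Pw (a, c, b))
    (hsum : ∑ x, Pw x = n) {c₀ : ℝ} (hc₀ : 0 < c₀)
    (hroth : ∀ N : ℕ, 2 ≤ N → c₀ * N * Real.exp (-2 * Real.sqrt (2 * Real.log 2 * Real.log N)) /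
      Real.sqrt (Real.log N) ≤ rothNumberNat N) :
    ∃ (s : ℕ) (a b c : Fin s → (Fin n → ZMod q)), IsTricoloredSumFree a b c ∧
      1 ≤ (typeClass n (fun k : Fin q =>
          ∑ x ∈ Finset.univ.filter (fun x : Fin q × Fin q × Fin q => x.1 = k), Pw x)).card ∧
      c₀ * (typeClass n (fun k : Fin q =>
          ∑ x ∈ Finset.univ.filter (fun x : Fin q × Fin q × Fin q => x.1 = k), Pw x)).card *
        Real.exp (-2 * Real.sqrt (2 * Real.log 2 *
          (Real.log (typeClass n (fun k : Fin q =>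
            ∑ x ∈ Finset.univ.filter (fun x : Fin q × Fin q × Fin q => x.1 = k), Pw x)).card +
            Real.log (3 * q)))) /
        Real.sqrt (Real.log (typeClass n (fun k : Fin q =>
            ∑ x ∈ Finset.univ.filter (fun x : Fin q × Fin q × Fin q => x.1 = k), Pw x)).card +
            Real.log (3 * q)) ≤ 96 * q * s := by
  classical
  obtain ⟨m, rfl⟩ : ∃ m, q = m + 1 := ⟨q - 1, by omega⟩
  simp only [Nat.add_sub_cancel] at hsupp
  set μ : Fin (m + 1) → ℕ := fun k =>
    ∑ x ∈ Finset.univ.filter (fun x : Fin (m+1) × Fin (m+1) × Fin (m+1) => x.1 = k), Pw x with hμ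
  set T : Finset (Fin (m+1) × Fin (m+1) × Fin (m+1)) :=
    Finset.univ.filter (fun x => (x.1:ℕ) + x.2.1 + x.2.2 = m) with hT
  have hmemT : ∀ x, x ∈ T ↔ (x.1:ℕ) + x.2.1 + x.2.2 = m := fun x => by simp [hT]
  -- a word of triples of type `Pw`, and its three projections
  obtain ⟨ω, hω⟩ := typeClass_nonempty n Pw hsum
  rw [mem_typeClass] at hω
  have hωT : ∀ ρ, ω ρ ∈ T := fun ρ => (hmemT _).2 (hsupp _ (by
    rw [← hω]; exact (letterCount_pos_of_apply ω ρ).ne'))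
  have hx : letterCount (fun ρ => (ω ρ).1) = μ := letterCount_proj ω hω Prod.fst
  have hy : letterCount (fun ρ => (ω ρ).2.1) = μ := by
    rw [letterCount_proj ω hω (fun x => x.2.1)]; funext k; exact marginal_snd_eq Pw h12 k
  have hz : letterCount (fun ρ => (ω ρ).2.2) = μ := by
    rw [letterCount_proj ω hω (fun x => x.2.2)]; funext k; exact marginal_thd_eq Pw h12 h23 k
  have hne : (typedSupport T n μ μ μ).Nonempty :=
    ⟨(fun ρ => (ω ρ).1, fun ρ => (ω ρ).2.1, fun ρ => (ω ρ).2.2),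
      mem_typedSupport.2 ⟨hx, hy, hz, fun ρ => hωT ρ⟩⟩
  -- the moment identity `3 Σ k μ(k) = m n`
  have h3 : 3 * ∑ k : Fin (m + 1), (k:ℕ) * μ k = m * n := by
    rw [← hsum]; exact three_mul_sum_marginal Pw hsupp h12 h23
  -- tightness data (`r = 1`, `b = m`)
  let α : Fin (m + 1) → Fin 1 → ℤ := fun a _ => ((a : ℕ) : ℤ)
  let γ : Fin (m + 1) → Fin 1 → ℤ := fun c _ => ((c : ℕ) : ℤ) - m
  have hαinj : Function.Injective α := fun a a' h => by
    have := congrFun h 0; simp only [α, Nat.cast_inj] at this; exact Fin.ext this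
  have hγinj : Function.Injective γ := fun a a' h => by
    have := congrFun h 0; simp only [γ, sub_left_inj, Nat.cast_inj] at this; exact Fin.ext this
  have hαb : ∀ a ρ, |α a ρ| ≤ m := fun a ρ => by
    simp only [α, Nat.abs_cast, Nat.cast_le]; omega
  have htight : ∀ t ∈ T, ∀ ρ, α t.1 ρ + α t.2.1 ρ + γ t.2.2 ρ = 0 := by
    intro t ht ρ
    have := (hmemT t).1 ht
    simp only [α, γ]
    push_cast [← this]
    ring
  obtain ⟨Δ, hΔsub, hfree, f, hf1, hfW, hsize⟩ :=
    exists_free_diagonal_typedSupport_fibre T α α γ hαinj hαinj hγinj hαb hαb htight n μ μ μ hne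
  -- the sum-free family indexed by `Δ`
  have hfreeΔ : IsTricoloredSumFree
      (fun δ : Δ => fun ρ => ((δ.1.1 ρ : ℕ) : ZMod (m + 1)))
      (fun δ : Δ => fun ρ => ((δ.1.2.1 ρ : ℕ) : ZMod (m + 1)))
      (fun δ : Δ => fun ρ => ((δ.1.2.2 ρ : ℕ) : ZMod (m + 1)) + 1) := by
    intro i j k
    have hi := mem_typedSupport.1 (hΔsub i.2)
    have hj := mem_typedSupport.1 (hΔsub j.2)
    have hk := mem_typedSupport.1 (hΔsub k.2)
    constructor
    · intro h0
      have hge : ∀ ρ, m ≤ (i.1.1 ρ : ℕ) + j.1.2.1 ρ + k.1.2.2 ρ := by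
        intro ρ
        have hρ := congrFun h0 ρ
        simp only [Pi.add_apply, Pi.zero_apply] at hρ
        have hcast : (((i.1.1 ρ : ℕ) + j.1.2.1 ρ + k.1.2.2 ρ + 1 : ℕ) : ZMod (m + 1)) = 0 := by
          push_cast; rw [← hρ]; ring
        rw [ZMod.natCast_eq_zero_iff] at hcast
        have := Nat.le_of_dvd (Nat.succ_pos _) hcast
        omega
      have heq := coord_eq_of_ge h3 hi.1 hj.2.1 hk.2.2.1 hge
      have hmem : ∀ ρ, (i.1.1 ρ, j.1.2.1 ρ, k.1.2.2 ρ) ∈ T := fun ρ => (hmemT _).2 (heq ρ)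
      obtain ⟨e1, e2⟩ := hfree i.1 i.2 j.1 j.2 k.1 k.2 hmem
      exact ⟨Subtype.ext e1, Subtype.ext e2⟩
    · rintro ⟨rfl, rfl⟩
      funext ρ
      simp only [Pi.add_apply, Pi.zero_apply]
      have hm : (i.1.1 ρ : ℕ) + i.1.2.1 ρ + i.1.2.2 ρ = m := (hmemT _).1 (hi.2.2.2 ρ)
      have : (((i.1.1 ρ : ℕ) + i.1.2.1 ρ + i.1.2.2 ρ + 1 : ℕ) : ZMod (m + 1)) = 0 := by
        rw [hm]; exact ZMod.natCast_self (m + 1)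
      push_cast at this
      rw [← this]; ring
  -- the size bound
  have hmin : min (typeClass n μ).card (min (typeClass n μ).card (typeClass n μ).card) =
      (typeClass n μ).card := by simp
  have hmax : max (typeClass n μ).card (max (typeClass n μ).card (typeClass n μ).card) =
      (typeClass n μ).card := by simp
  rw [hmin] at hsize
  rw [hmax] at hfW
  set W := (typeClass n μ).card with hW
  have hW1 : 1 ≤ W := le_trans hf1 hfW
  refine ⟨Δ.card, _, _, _, hfreeΔ.comp (e := (Δ.equivFin).symm) (Δ.equivFin).symm.injective,
    hW1, ?_⟩
  set f' := max f m with hf'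
  have hf'1 : 1 ≤ f' := le_trans hf1 (le_max_left _ _)
  have hff' : f ≤ f' := le_max_left _ _
  have hf'le : f' ≤ f * (m + 1) := by
    refine max_le ?_ ?_
    · exact Nat.le_mul_of_pos_right f (Nat.succ_pos m)
    · calc m ≤ 1 * (m + 1) := by omega
        _ ≤ f * (m + 1) := Nat.mul_le_mul_right _ hf1
  have hf'W : f' ≤ (m + 1) * W := by
    refine max_le (hfW.trans (Nat.le_mul_of_pos_left W (Nat.succ_pos m))) ?_
    calc m ≤ (m + 1) * 1 := by omega
      _ ≤ (m + 1) * W := Nat.mul_le_mul_left _ hW1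
  -- Behrend (sharp) for `N = 3 f'`
  set N₃ : ℕ := 3 * f' with hN₃
  have hN₃2 : 2 ≤ N₃ := by omega
  have hB := hroth N₃ hN₃2
  have hN₃R : (2:ℝ) ≤ N₃ := by exact_mod_cast hN₃2
  have hlogN₃ : 0 < Real.log N₃ := Real.log_pos (by linarith)
  -- `log N₃ ≤ Λ := log W + log (3 (m+1))`
  set Λ : ℝ := Real.log W + Real.log (3 * ((m + 1 : ℕ) : ℝ)) with hΛ
  have hWR : (1:ℝ) ≤ W := by exact_mod_cast hW1
  have hΛN : Real.log N₃ ≤ Λ := by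
    have hle : (N₃ : ℝ) ≤ (W : ℝ) * (3 * ((m + 1 : ℕ) : ℝ)) := by
      have : (N₃ : ℝ) ≤ ((3 * ((m + 1) * W) : ℕ) : ℝ) := by
        exact_mod_cast Nat.mul_le_mul_left 3 hf'W
      push_cast at this ⊢
      linarith
    calc Real.log N₃ ≤ Real.log ((W : ℝ) * (3 * ((m + 1 : ℕ) : ℝ))) :=
          Real.log_le_log (by linarith) hle
      _ = Λ := by rw [hΛ, Real.log_mul (by linarith) (by positivity)]
  have hfac := behrendFactor_antitone hlogN₃ hΛN
  -- combine: `c₀ W g(Λ) · (f N₃) ≤ 96 (m+1) |Δ| · (f N₃)`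
  have hsizeR : (W : ℝ) * f * rothNumberNat N₃ ≤ 288 * (f' : ℝ) ^ 2 * Δ.card := by
    exact_mod_cast hsize
  have hgΛ : 0 ≤ Real.exp (-2 * Real.sqrt (2 * Real.log 2 * Λ)) / Real.sqrt Λ := by positivity
  have key : c₀ * W * (Real.exp (-2 * Real.sqrt (2 * Real.log 2 * Λ)) / Real.sqrt Λ) *
      ((f : ℝ) * N₃) ≤ (96 * ((m + 1 : ℕ) : ℝ) * Δ.card) * ((f : ℝ) * N₃) := by
    have hf0 : (0:ℝ) ≤ f := Nat.cast_nonneg f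
    have hf'R : ((f' : ℕ) : ℝ) ≤ (f : ℝ) * ((m + 1 : ℕ) : ℝ) := by exact_mod_cast hf'le
    have hΔ0 : (0:ℝ) ≤ Δ.card := Nat.cast_nonneg _
    have h1 : c₀ * (N₃ : ℝ) * (Real.exp (-2 * Real.sqrt (2 * Real.log 2 * Λ)) / Real.sqrt Λ) ≤
        rothNumberNat N₃ := by
      refine le_trans ?_ hB
      rw [mul_div_assoc]
      exact mul_le_mul_of_nonneg_left hfac (by positivity)
    calc c₀ * W * (Real.exp (-2 * Real.sqrt (2 * Real.log 2 * Λ)) / Real.sqrt Λ) * ((f : ℝ) * N₃)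
        = (W : ℝ) * f * (c₀ * (N₃ : ℝ) *
            (Real.exp (-2 * Real.sqrt (2 * Real.log 2 * Λ)) / Real.sqrt Λ)) := by ring
      _ ≤ (W : ℝ) * f * rothNumberNat N₃ := mul_le_mul_of_nonneg_left h1 (by positivity)
      _ ≤ 288 * (f' : ℝ) ^ 2 * Δ.card := hsizeR
      _ = (96 * (f' : ℝ) * Δ.card) * N₃ := by rw [hN₃]; push_cast; ring
      _ ≤ (96 * ((f : ℝ) * ((m + 1 : ℕ) : ℝ)) * Δ.card) * N₃ := by
          refine mul_le_mul_of_nonneg_right ?_ (Nat.cast_nonneg _)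
          exact mul_le_mul_of_nonneg_right (mul_le_mul_of_nonneg_left hf'R (by norm_num)) hΔ0
      _ = (96 * ((m + 1 : ℕ) : ℝ) * Δ.card) * ((f : ℝ) * N₃) := by ring
  have hpos : (0:ℝ) < (f : ℝ) * N₃ := by
    have : (1:ℝ) ≤ f := by exact_mod_cast hf1
    positivity
  have hfin := le_of_mul_le_mul_right key hpos
  rw [hΛ] at hfin
  rw [mul_div_assoc]
  exact hfin


/-- The type class of `μ` has at most `e^{n H(μ/n)}` elements (method of types, upper half; the
tree's `multinomial_le_exp_mul_sum_negMulLog`) — KSS Lemma 3, upper bound.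
[cite: KleinbergSawinSpeyer2018, Lemma 3] -/
theorem card_typeClass_le_exp_entropy {q n : ℕ} (μ : Fin q → ℕ) (hμ : ∑ k, μ k = n) :
    ((typeClass n μ).card : ℝ) ≤ Real.exp (n * ∑ k, Real.negMulLog ((μ k : ℝ) / n)) := by
  have h := multinomial_le_exp_mul_sum_negMulLog μ hμ
  rw [← card_typeClass_eq_multinomial n μ hμ] at h
  exact h

/-- **The final estimate** (KSS, proof of Thm. 13, p. 9: "`|W| ≥ θⁿ exp(−O_q(log n))`",
"`e^{−2√(2 log 2 log p)} > e^{−2√(2 log 2 log θ n) − O_q(1/√n)}`"), isolated as real analysis: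
from the entropy bounds for the empirical distribution, the two method-of-types bounds for `|W|`,
the size of the free diagonal and `log n ≥ K₅(q)` we get
`θⁿ e^{−2√(2 log 2 log θ · n) − (q+2) log n} ≤ s`. [cite: KleinbergSawinSpeyer2018, Theorem 13 (proof)] -/
theorem final_estimate {m n n₁ t : ℕ} {θ H K₁ W c₀ Lq : ℝ} {sz : ℕ}
    (hθ1 : 1 ≤ θ) (hn1 : 1 ≤ n) (hn₁1 : 1 ≤ n₁) (hn₁n : n₁ ≤ n) (hn₁t : (n:ℝ) - t ≤ n₁)
    (hW1 : 1 ≤ W) (hc₀ : 0 < c₀) (hLq1 : 1 ≤ Lq)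
    (hHlow : n₁ * Real.log θ - K₁ ≤ n₁ * H) (hHupp : H ≤ Real.log θ)
    (hWlow : Real.exp (n₁ * H) ≤ ((n₁:ℝ) + 1) ^ (m + 1) * W) (hWupp : W ≤ Real.exp (n₁ * H))
    (hGsz : c₀ * W * Real.exp (-2 * Real.sqrt (2 * Real.log 2 * (Real.log W + Lq))) /
      Real.sqrt (Real.log W + Lq) ≤ 96 * ((m:ℝ) + 1) * sz)
    (hlognK : -Real.log (c₀ / (96 * ((m:ℝ) + 1))) + t * Real.log θ + K₁ +
      ((m:ℝ) + 1) * Real.log 2 + 2 * Real.sqrt (2 * Real.log 2 * Lq) +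
      (1 / 2) * Real.log (Real.log θ + Lq) ≤ Real.log n) :
    θ ^ n * Real.exp (-(2 * Real.sqrt (2 * Real.log 2 * Real.log θ * n)) -
      ((m:ℝ) + 3) * Real.log n) ≤ sz := by
  -- `√(a + b) ≤ √a + √b`
  have hsub : ∀ a b : ℝ, 0 ≤ a → 0 ≤ b → Real.sqrt (a + b) ≤ Real.sqrt a + Real.sqrt b := by
    intro a b ha hb
    rw [Real.sqrt_le_iff]
    refine ⟨by positivity, ?_⟩
    nlinarith [Real.sq_sqrt ha, Real.sq_sqrt hb, Real.sqrt_nonneg a, Real.sqrt_nonneg b]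
  have hθ0 : 0 < θ := by linarith
  have hlogθ : 0 ≤ Real.log θ := Real.log_nonneg hθ1
  have hnR1 : (1:ℝ) ≤ n := by exact_mod_cast hn1
  have hn0 : (0:ℝ) < n := by linarith
  have hlogn0 : 0 ≤ Real.log n := Real.log_nonneg hnR1
  have hn₁R : (0:ℝ) < n₁ := by exact_mod_cast hn₁1
  have hn₁Rn : (n₁:ℝ) ≤ n := by exact_mod_cast hn₁n
  have hW0 : 0 < W := by linarith
  have hlogW0 : 0 ≤ Real.log W := Real.log_nonneg hW1
  have hl2 : 0 ≤ Real.log 2 := Real.log_nonneg one_le_two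
  set Λ : ℝ := Real.log W + Lq with hΛ
  have hΛ1 : 1 ≤ Λ := by rw [hΛ]; linarith
  have hΛ0 : 0 < Λ := by linarith
  set G : ℝ := c₀ * W * Real.exp (-2 * Real.sqrt (2 * Real.log 2 * Λ)) / Real.sqrt Λ with hG
  have hGpos : 0 < G := by rw [hG]; positivity
  have hq96 : (0:ℝ) < 96 * ((m:ℝ) + 1) := by positivity
  have hGsz' : G ≤ 96 * ((m:ℝ) + 1) * sz := by rw [hG, hΛ]; exact hGsz
  -- component inequalities
  have c1 : (n₁:ℝ) * H ≤ ((m:ℝ) + 1) * Real.log ((n₁:ℝ) + 1) + Real.log W := by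
    have hpow0 : ((n₁:ℝ) + 1) ^ (m + 1) ≠ 0 := by positivity
    have := Real.log_le_log (Real.exp_pos _) hWlow
    rw [Real.log_exp, Real.log_mul hpow0 hW0.ne', Real.log_pow] at this
    push_cast at this
    linarith
  have c3 : ((n:ℝ) - t) * Real.log θ ≤ n₁ * Real.log θ :=
    mul_le_mul_of_nonneg_right hn₁t hlogθ
  have c4 : Real.log ((n₁:ℝ) + 1) ≤ Real.log n + Real.log 2 := by
    have h2n : Real.log ((n:ℝ) * 2) = Real.log n + Real.log 2 :=
      Real.log_mul hn0.ne' (by norm_num)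
    rw [← h2n]
    exact Real.log_le_log (by linarith) (by linarith)
  have c4' : ((m:ℝ) + 1) * Real.log ((n₁:ℝ) + 1) ≤ ((m:ℝ) + 1) * (Real.log n + Real.log 2) :=
    mul_le_mul_of_nonneg_left c4 (by positivity)
  have hΛupp : Λ ≤ n * Real.log θ + Lq := by
    have hlogWle : Real.log W ≤ n₁ * H := by
      have := Real.log_le_log hW0 hWupp
      rwa [Real.log_exp] at this
    have h2 : (n₁:ℝ) * H ≤ n₁ * Real.log θ := mul_le_mul_of_nonneg_left hHupp hn₁R.le
    have h3 : (n₁:ℝ) * Real.log θ ≤ n * Real.log θ := mul_le_mul_of_nonneg_right hn₁Rn hlogθ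
    rw [hΛ]; linarith
  have c5 : Real.sqrt (2 * Real.log 2 * Λ) ≤
      Real.sqrt (2 * Real.log 2 * Real.log θ * n) + Real.sqrt (2 * Real.log 2 * Lq) := by
    have e : 2 * Real.log 2 * (n * Real.log θ + Lq) =
        2 * Real.log 2 * Real.log θ * n + 2 * Real.log 2 * Lq := by ring
    have h1 : Real.sqrt (2 * Real.log 2 * Λ) ≤ Real.sqrt (2 * Real.log 2 * (n * Real.log θ + Lq)) :=
      Real.sqrt_le_sqrt (mul_le_mul_of_nonneg_left hΛupp (by positivity))
    rw [e] at h1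
    have h2 := hsub (2 * Real.log 2 * Real.log θ * n) (2 * Real.log 2 * Lq) (by positivity)
      (by positivity)
    linarith
  have c6 : Real.log Λ ≤ Real.log n + Real.log (Real.log θ + Lq) := by
    have hLpos : 0 < Real.log θ + Lq := by linarith
    have h1 : Λ ≤ n * (Real.log θ + Lq) := by
      have : Lq ≤ n * Lq := le_mul_of_one_le_left (by linarith) hnR1
      linarith [hΛupp]
    have hmul : Real.log ((n:ℝ) * (Real.log θ + Lq)) = Real.log n + Real.log (Real.log θ + Lq) :=
      Real.log_mul hn0.ne' hLpos.ne'
    rw [← hmul]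
    exact Real.log_le_log hΛ0 h1
  -- `log (G / (96 q))`
  have hsqΛ : Real.sqrt Λ ≠ 0 := (Real.sqrt_pos.2 hΛ0).ne'
  have hE0 : Real.exp (-2 * Real.sqrt (2 * Real.log 2 * Λ)) ≠ 0 := (Real.exp_pos _).ne'
  have hcW : c₀ * W ≠ 0 := by positivity
  have hcWE : c₀ * W * Real.exp (-2 * Real.sqrt (2 * Real.log 2 * Λ)) ≠ 0 := by positivity
  have hlogG : Real.log (G / (96 * ((m:ℝ) + 1))) = Real.log (c₀ / (96 * ((m:ℝ) + 1))) +
      Real.log W - 2 * Real.sqrt (2 * Real.log 2 * Λ) - Real.log Λ / 2 := by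
    rw [Real.log_div hGpos.ne' hq96.ne', hG, Real.log_div hcWE hsqΛ, Real.log_mul hcW hE0,
      Real.log_mul hc₀.ne' hW0.ne', Real.log_exp, Real.log_sqrt hΛ0.le,
      Real.log_div hc₀.ne' hq96.ne']
    ring
  -- the exponent comparison
  have hAB : (n:ℝ) * Real.log θ - 2 * Real.sqrt (2 * Real.log 2 * Real.log θ * n) -
      ((m:ℝ) + 3) * Real.log n ≤ Real.log (G / (96 * ((m:ℝ) + 1))) := by
    rw [hlogG]
    linarith [c1, c3, c4', c5, c6, hHlow, hlognK, hlogn0]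
  -- conclude
  calc θ ^ n * Real.exp (-(2 * Real.sqrt (2 * Real.log 2 * Real.log θ * n)) -
        ((m:ℝ) + 3) * Real.log n)
      = Real.exp ((n:ℝ) * Real.log θ - 2 * Real.sqrt (2 * Real.log 2 * Real.log θ * n) -
          ((m:ℝ) + 3) * Real.log n) := by
        rw [← Real.exp_log (pow_pos hθ0 n), ← Real.exp_add, Real.log_pow]; congr 1; ring
    _ ≤ Real.exp (Real.log (G / (96 * ((m:ℝ) + 1)))) := Real.exp_le_exp.2 hAB
    _ = G / (96 * ((m:ℝ) + 1)) := Real.exp_log (div_pos hGpos hq96)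
    _ ≤ sz := by rw [div_le_iff₀ hq96]; linarith [hGsz']

end KleinbergSawinSpeyer

open KleinbergSawinSpeyer Literature.Computability.AlgebraicComplexity in
/-- **Kleinberg–Sawin–Speyer 2018, Theorem 2** — discharge of the named fact
`KleinbergSawinSpeyer2018_thm2`: for every integer `q ≥ 2` there are `C` and `n₀` such that for
every `n ≥ n₀` some tricolored sum-free family in `(ℤ/q)ⁿ` has at least
`θ_qⁿ · exp(−2√(2 log 2 · log θ_q · n) − C log n)` members (here `C = q + 2`).  Proof: KSS §4
(Thm. 13) with Pebody's Theorem 4, rounding at scale `n` and the second-order entropy estimate,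
the hashing theorem with the fibre bound `p ≤ 12 q |W|`, and Behrend's theorem with the sharp
constant. [cite: KleinbergSawinSpeyer2018, Theorem 2 (and Theorem 13)] -/
theorem KleinbergSawinSpeyer2018_thm2_holds : KleinbergSawinSpeyer2018_thm2 := by
  intro q hq
  classical
  obtain ⟨m, rfl⟩ : ∃ m, q = m + 1 := ⟨q - 1, by omega⟩
  have hm : 1 ≤ m := by omega
  have hq1 : 1 ≤ m + 1 := by omega
  -- the constants `θ, ρ, Z, p₀`
  set θ := kssTheta (m + 1) with hθ
  have hθ1 : 1 ≤ θ := one_le_kssTheta hq1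
  have hθ0 : 0 < θ := by linarith
  have hlogθ : 0 ≤ Real.log θ := Real.log_nonneg hθ1
  obtain ⟨ρ, hρ0, hρ1, hρ⟩ := exists_rho m hm
  have hρ' : ∑ k ∈ Finset.range (m + 1), (3 * (k:ℝ) - ((m + 1 : ℕ) - 1)) * ρ ^ k = 0 := by
    push_cast; simpa using hρ
  set Z := ∑ j ∈ Finset.range (m + 1), ρ ^ j with hZ
  have hZpos : 0 < Z := by
    have := Finset.single_le_sum (f := fun i => ρ ^ i) (fun i _ => pow_nonneg hρ0.le i)
      (Finset.mem_range.2 hq1)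
    simp only [pow_zero] at this
    rw [hZ]; linarith
  set p₀ : Fin (m + 1) → ℝ := fun k => ρ ^ (k:ℕ) / Z with hp₀
  have hH₀ : Real.log θ ≤ ∑ k, Real.negMulLog (p₀ k) := log_kssTheta_le_entropy hq1 hρ0 hρ1 hρ'
  have hH₀' : ∑ k, Real.negMulLog (p₀ k) = Real.log (Z * ρ ^ (-((((m + 1 : ℕ) : ℝ) - 1) / 3))) :=
    entropy_psi hq1 hρ0 hρ'
  set pmin : ℝ := ρ ^ m / Z with hpmin
  have hpmin0 : 0 < pmin := div_pos (pow_pos hρ0 m) hZpos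
  have hp₀min : ∀ k : Fin (m + 1), pmin ≤ p₀ k := fun k =>
    div_le_div_of_nonneg_right (pow_le_pow_of_le_one hρ0.le hρ1.le (Nat.lt_succ_iff.1 k.is_lt))
      hZpos.le
  -- the distribution: Pebody, symmetrised
  set ψ : ℕ → ℝ := fun k => if k ≤ m then ρ ^ k else 0 with hψ
  have hψanti : Antitone ψ := by
    intro a b hab
    simp only [hψ]
    split_ifs with h1 h2 h2
    · exact pow_le_pow_of_le_one hρ0.le hρ1.le hab
    · omega
    · positivity
    · exact le_rfl
  have hψv : ∀ k, m < k → ψ k = 0 := fun k hk => by simp [hψ, Nat.not_le.2 hk]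
  have hψr : ∀ k ∈ Finset.range (m + 1), ψ k = ρ ^ k := fun k hk => by
    simp [hψ, Nat.lt_succ_iff.1 (Finset.mem_range.1 hk)]
  have hψZ : ∑ k ∈ Finset.range (m + 1), ψ k = Z := Finset.sum_congr rfl hψr
  have hψmom : 3 * ∑ k ∈ Finset.range (m + 1), (k:ℝ) * ψ k =
      m * ∑ k ∈ Finset.range (m + 1), ψ k := by
    rw [hψZ, Finset.sum_congr rfl fun k hk => by rw [hψr k hk]]
    have : ∑ k ∈ Finset.range (m + 1), (3 * (k:ℝ) - m) * ρ ^ k =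
        3 * ∑ k ∈ Finset.range (m + 1), (k:ℝ) * ρ ^ k - m * Z := by
      rw [hZ, Finset.mul_sum, Finset.mul_sum, ← Finset.sum_sub_distrib]
      exact Finset.sum_congr rfl fun k _ => by ring
    linarith
  obtain ⟨P, hP0, hPs, hP12, hP23, hPmarg⟩ :=
    exists_symmetric_weight m ψ hψanti hψv hψmom (by rw [hψZ]; exact hZpos)
  have hPmarg' : ∀ k : Fin (m + 1),
      ∑ x ∈ Finset.univ.filter (fun x : Fin (m+1) × Fin (m+1) × Fin (m+1) => x.1 = k), P x =
        p₀ k := by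
    intro k
    rw [hPmarg k, hψZ, hp₀]
    simp only [hψ, if_pos (Nat.lt_succ_iff.1 k.is_lt)]
  have hP1 : ∑ x, P x = 1 := by
    rw [← Finset.sum_fiberwise Finset.univ (fun x : Fin (m+1) × Fin (m+1) × Fin (m+1) => x.1) P]
    rw [Finset.sum_congr rfl fun k _ => hPmarg' k]
    simp only [hp₀]
    rw [← Finset.sum_div, Fin.sum_univ_eq_sum_range (fun k => ρ ^ k) (m + 1), ← hZ,
      div_self hZpos.ne']
  -- rounding data and Behrend's constant
  obtain ⟨t, Cr, ht, hCr, hround⟩ := exists_integral_weight_scale hq1 P hP0 hPs hP12 hP23 hP1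
  obtain ⟨c₀, hc₀, hroth⟩ := roth_lower_bound_sharp'
  -- constants of the final estimate
  set Lq : ℝ := Real.log (3 * ((m:ℝ) + 1)) with hLq
  have hLq1 : 1 ≤ Lq := by
    have h6 : (6:ℝ) ≤ 3 * ((m:ℝ) + 1) := by
      have : (1:ℝ) ≤ m := by exact_mod_cast hm
      linarith
    have : Real.log 6 ≤ Lq := Real.log_le_log (by norm_num) h6
    have h1 : (1:ℝ) ≤ Real.log 6 := by
      rw [Real.le_log_iff_exp_le (by norm_num)]
      have := Real.exp_one_lt_d9; norm_num at this; linarith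
    linarith
  set K₁ : ℝ := ((m:ℝ) + 1) * Cr ^ 2 / pmin with hK₁
  have hK₁0 : 0 ≤ K₁ := by rw [hK₁]; positivity
  set K₅ : ℝ := -Real.log (c₀ / (96 * ((m:ℝ) + 1))) + t * Real.log θ + K₁ +
    ((m:ℝ) + 1) * Real.log 2 + 2 * Real.sqrt (2 * Real.log 2 * Lq) +
    (1 / 2) * Real.log (Real.log θ + Lq) with hK₅
  obtain ⟨Nexp, hNexp⟩ := exists_nat_gt (Real.exp K₅)
  refine ⟨(m:ℝ) + 3, max (max t Nexp) 1, fun n hn => ?_⟩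
  have hnt : t ≤ n := le_trans (le_max_left _ _) (le_trans (le_max_left _ _) hn)
  have hnN : Nexp ≤ n := le_trans (le_max_right _ _) (le_trans (le_max_left _ _) hn)
  have hn1 : 1 ≤ n := le_trans (le_max_right _ _) hn
  have hlognK : K₅ ≤ Real.log n := by
    have h1 : Real.exp K₅ < n := hNexp.trans_le (by exact_mod_cast hnN)
    have := Real.log_le_log (Real.exp_pos _) h1.le
    rwa [Real.log_exp] at this
  -- the scale: `n₁ = t N`, `N = n / t`
  set N := n / t with hNdef
  have hN1 : 1 ≤ N := (Nat.one_le_div_iff ht).2 hnt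
  set n₁ := t * N with hn₁
  have hn₁n : n₁ ≤ n := by rw [hn₁, mul_comm]; exact Nat.div_mul_le_self n t
  have hn₁1 : 1 ≤ n₁ := Nat.mul_pos ht hN1
  have hn₁lt : n < n₁ + t := by rw [hn₁, hNdef, mul_comm]; exact Nat.lt_div_mul_add ht
  have hn₁R : (0:ℝ) < n₁ := by exact_mod_cast hn₁1
  have hn₁R' : (n:ℝ) - t ≤ n₁ := by
    have : (n:ℝ) < n₁ + t := by exact_mod_cast hn₁lt
    linarith
  obtain ⟨Pw, hsupp, h12, h23, hsum, happrox⟩ := hround N hN1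
  have hsupp' : ∀ x, Pw x ≠ 0 → (x.1:ℕ) + x.2.1 + x.2.2 = m := fun x hx => by
    have := hsupp x hx; omega
  -- the marginal `μ` and the probability vector `p = μ / n₁`
  set μ : Fin (m + 1) → ℕ := fun k =>
    ∑ x ∈ Finset.univ.filter (fun x : Fin (m+1) × Fin (m+1) × Fin (m+1) => x.1 = k), Pw x with hμ
  have hμsum : ∑ k, μ k = n₁ := by
    simp only [hμ]
    rw [Finset.sum_fiberwise Finset.univ (fun x : Fin (m+1) × Fin (m+1) × Fin (m+1) => x.1) Pw,
      hsum, hn₁]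
  have h3 : 3 * ∑ k : Fin (m + 1), (k:ℕ) * μ k = m * n₁ := by
    rw [hn₁, ← hsum]; exact three_mul_sum_marginal Pw hsupp' h12 h23
  obtain ⟨p, hp⟩ : ∃ p : Fin (m + 1) → ℝ, ∀ k, p k = (μ k : ℝ) / n₁ := ⟨_, fun _ => rfl⟩
  have hp0 : ∀ k, 0 ≤ p k := fun k => by rw [hp]; positivity
  have hp1 : ∑ k, p k = 1 := by
    simp_rw [hp]
    rw [← Finset.sum_div, ← Nat.cast_sum, hμsum, div_self hn₁R.ne']
  have hpmean : ∑ k : Fin (m + 1), ((k:ℕ):ℝ) * p k = (((m + 1 : ℕ) : ℝ) - 1) / 3 := by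
    have h3R : (3:ℝ) * ∑ k : Fin (m + 1), ((k:ℕ):ℝ) * μ k = m * n₁ := by exact_mod_cast h3
    simp_rw [hp]
    have : ∑ k : Fin (m + 1), ((k:ℕ):ℝ) * ((μ k : ℝ) / n₁) =
        (∑ k : Fin (m + 1), ((k:ℕ):ℝ) * μ k) / n₁ := by
      rw [Finset.sum_div]; exact Finset.sum_congr rfl fun k _ => by ring
    rw [this, div_eq_iff hn₁R.ne']
    push_cast
    linarith
  have hpclose : ∀ k, |p k - p₀ k| ≤ Cr / n₁ := by
    intro k
    have h := happrox k
    rw [hPmarg' k] at h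
    rw [hp, le_div_iff₀ hn₁R]
    have e : |(μ k : ℝ) / n₁ - p₀ k| * n₁ = |(μ k : ℝ) - (t * N : ℕ) * p₀ k| := by
      rw [show (μ k : ℝ) / n₁ - p₀ k = ((μ k : ℝ) - (t * N : ℕ) * p₀ k) / n₁ from by
        rw [hn₁]; field_simp, abs_div, abs_of_pos hn₁R, div_mul_cancel₀ _ hn₁R.ne']
    rw [e]
    have hμk : (μ k : ℝ) = ∑ x ∈ Finset.univ.filter
        (fun x : Fin (m+1) × Fin (m+1) × Fin (m+1) => x.1 = k), (Pw x : ℝ) := by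
      simp only [hμ]; push_cast; rfl
    rw [hμk]
    exact h
  -- entropy of `p`: lower and upper bounds
  set H : ℝ := ∑ k, Real.negMulLog (p k) with hH
  have hHlow : (n₁:ℝ) * Real.log θ - K₁ ≤ n₁ * H := by
    have hG := entropy_ge_sub_chiSq hq1 p hp0 hp1 hpmean hρ0
    rw [← hZ, ← hH₀'] at hG
    have hchi : ∑ k : Fin (m + 1), (p k - ρ ^ (k:ℕ) / Z) ^ 2 / (ρ ^ (k:ℕ) / Z) ≤
        ((m:ℝ) + 1) * ((Cr / n₁) ^ 2 / pmin) := by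
      calc ∑ k : Fin (m + 1), (p k - ρ ^ (k:ℕ) / Z) ^ 2 / (ρ ^ (k:ℕ) / Z)
          ≤ ∑ _k : Fin (m + 1), (Cr / n₁) ^ 2 / pmin := by
            refine Finset.sum_le_sum fun k _ => ?_
            have h1 : (p k - ρ ^ (k:ℕ) / Z) ^ 2 ≤ (Cr / n₁) ^ 2 := by
              have := hpclose k
              rw [hp₀] at this
              rw [← sq_abs]
              exact pow_le_pow_left₀ (abs_nonneg _) this 2
            exact div_le_div₀ (by positivity) h1 hpmin0 (hp₀min k)
        _ = ((m:ℝ) + 1) * ((Cr / n₁) ^ 2 / pmin) := by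
            rw [Finset.sum_const, Finset.card_univ, Fintype.card_fin, nsmul_eq_mul]; push_cast; ring
    have hK : (n₁:ℝ) * (((m:ℝ) + 1) * ((Cr / n₁) ^ 2 / pmin)) ≤ K₁ := by
      have e : (n₁:ℝ) * (((m:ℝ) + 1) * ((Cr / n₁) ^ 2 / pmin)) = K₁ / n₁ := by
        rw [hK₁]; field_simp
      rw [e]
      exact div_le_self hK₁0 (by exact_mod_cast hn₁1)
    set χ : ℝ := ∑ k : Fin (m + 1), (p k - ρ ^ (k:ℕ) / Z) ^ 2 / (ρ ^ (k:ℕ) / Z) with hχ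
    have e1 : Real.log θ - χ ≤ H := by linarith [hG, hH₀]
    have e2 : (n₁:ℝ) * (Real.log θ - χ) ≤ n₁ * H := mul_le_mul_of_nonneg_left e1 hn₁R.le
    have e3 : (n₁:ℝ) * χ ≤ K₁ := (mul_le_mul_of_nonneg_left hchi hn₁R.le).trans hK
    linarith [e2, e3]
  have hHupp : H ≤ Real.log θ := entropy_le_log_kssTheta hq1 p hp0 hp1 hpmean
  -- the type class `W`
  have hWlow := exp_entropy_le_card_typeClass μ hμsum
  have hWupp := card_typeClass_le_exp_entropy μ hμsum
  rw [show (fun k => Real.negMulLog ((μ k : ℝ) / n₁)) = fun k => Real.negMulLog (p k) from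
    funext fun k => by rw [hp]] at hWlow hWupp
  -- the construction at length `n₁`, padded to `n`
  obtain ⟨sz, a, b, c, hfree, hW1, hbound⟩ :=
    construction_sharp (q := m + 1) (by omega) Pw hsupp h12 h23 (hsum.trans hn₁.symm) hc₀ hroth
  obtain ⟨a', b', c', hfree'⟩ := isTricoloredSumFree_pad hn₁n hfree
  refine ⟨sz, a', b', c', hfree', ?_⟩
  have hW1R : (1:ℝ) ≤ (typeClass n₁ μ).card := by exact_mod_cast hW1
  push_cast at hbound
  exact final_estimate hθ1 hn1 hn₁1 hn₁n hn₁R' hW1R hc₀ hLq1 hHlow hHupp hWlow hWupp hbound hlognK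

end Literature.Combinatorics.Additive
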